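import Literature.Probability.RandomPlanarGeometry.RestrictionPullback
import Literature.Probability.RandomPlanarGeometry.RestrictionCovariance
import Literature.Probability.RandomPlanarGeometry.ArcHullDomains
import HarnessLib

/-!
# The uniqueness half of [LSW] p. 5 result 2, assembled (`LawlerSchrammWerner2003_unique`)

Proof-only file. We prove `Literature.Probability.RandomPlanarGeometry.LawlerSchrammWerner2003_unique` (`ConformalRestrictionProofs`):

> two chordal families which are chordal, conformally covariant, satisfy two-sided restriction
> over hull subdomains and are carried by simple curves meeting the boundary only at the marked
> points coincide in every Dobrushin domain,

from the PRINTED half-plane statements of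

* G. F. Lawler, O. Schramm, W. Werner, *Conformal restriction: the chordal case*, J. Amer.
  Math. Soc. **16** (2003) 917–955, arXiv:math/0209343 (**[LSW]**) —
  Prop. 3.3 (1) ⇒ (3) (`exists_isRestrictionMeasure_of_isHullMultiplicative`), p. 5 result 2
  first sentence (`IsRestrictionMeasure.eq_five_eighths_of_outer_simple`), Lemma 2.1 with the
  Lemma 3.5 convergence of the restriction maps (`IsPlusHull.exists_antitone_isArcHull`), the
  `±`-factorisation
  (`IsStarHull.exists_isHullProduct_plus_minus`), existence and the derivative at `0` of `Φ_A`
  (`IsStarHull.existsUnique_isRestrictionMap`, `IsStarHull.exists_hasRestrictionDeriv`) —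

and the classical facts: the Jordan curve theorem and arc non-separation (`JordanCurveTheorem`,
`JordanArcSeparation`), Carathéodory (`JordanDomain.exists_continuousOn_extension`), the
Riemann mapping theorem (`exists_conformalEquiv_ball`, `JordanDomain.isSimplyConnected`) and
Conway VIII.2.2 (`isSimplyConnected_of_isConnected_compl`).

**Proof** (`LawlerSchrammWerner2003_unique_of_facts`), following the docstring of the fact.
Fix `D` and a chordal uniformizing map `φ : (ℍ; 0, ∞) → (D; a, b)`. The pull-back law
`P̃ = law of φ⁻¹(trace)` on `Ω` (`RestrictionPullback`) of such a family is a probability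
measure, dilation-invariant (conformal covariance), multiplicative over smooth hulls (restriction
over the Jordan hull subdomains `φ(ℍ ∖ J)`, `ArcHullDomains` + `pullbackLaw_avoid_hullProduct`),
hence multiplicative over all `*`-hulls (`RestrictionCovariance`), hence `P̃ = P_α`
(Prop. 3.3); every pulled-back configuration being a simple curve, `α = 5/8`. So the pull-backs
of `P` and `Q` have the same avoidance probabilities `Φ'_A(0)^{5/8}` of `*`-hulls. Finally two
laws on `D` carried by chordal simple curves with the same avoidance probabilities of the images
of the anchored test sets (whose fills are `*`-hulls, or whose avoidance is impossible) coincide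
(`CurveClass.Measure.ext_of_missCode_injOn` with `injOn_missCode_imageTest`).
-/

noncomputable section

open Set Filter Topology Metric MeasureTheory Complex
open UpperHalfPlane (upperHalfPlaneSet isOpen_upperHalfPlaneSet)
open scoped NNReal ENNReal

namespace Literature.Probability.RandomPlanarGeometry

open RestrictionConfig

variable {D : DobrushinDomain} {φ : ConformalEquiv upperHalfPlaneSet D.carrier}

/-! ### Avoiding a test set is avoiding its fill -/

/-- A configuration avoids a closed bounded `S` iff it avoids the half-plane fill of `S`
(it is connected and unbounded inside `ℍ ∖ S`, hence in the unbounded component). [folklore] -/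
theorem RestrictionConfig.disjoint_hpFill_iff (K : RestrictionConfig) {S : Set ℂ}
    (hS : IsClosed S) (hSb : Bornology.IsBounded S) :
    Disjoint (K : Set ℂ) (hpFill S) ↔ Disjoint (K : Set ℂ) S := by
  constructor
  · intro h
    refine Set.disjoint_left.2 fun z hz hzS ↦ ?_
    exact Set.disjoint_left.1 h hz (inter_subset_hpFill S ⟨hzS, K.subset_upperHalfPlaneSet hz⟩)
  · intro h
    have hsub : (K : Set ℂ) ⊆ upperHalfPlaneSet \ S := K.subset_diff_of_disjoint h
    have hV := subset_unboundedComponent_of_isPreconnected K.isConnected.isPreconnected hsub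
      K.not_isBounded
    rw [← diff_hpFill hS hSb] at hV
    exact Set.disjoint_left.2 fun z hz ↦ (hV hz).2

/-! ### The pull-back law is `P_{5/8}` -/

section Pullback

variable (hJCT : Literature.Topology.PlaneTopology.JordanCurveTheorem) (hJarc : Literature.Topology.PlaneTopology.JordanArcSeparation)
  (hC : JordanDomain.exists_continuousOn_extension)
  (hsc : ∀ D : JordanDomain, D.isSimplyConnected)
  (hRM : ∀ {U : Set ℂ}, exists_conformalEquiv_ball (U := U))
  (hexΦ : IsStarHull.existsUnique_isRestrictionMap)
  (hFa : isSimplyConnected_of_isConnected_compl)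
  (h21 : IsPlusHull.exists_antitone_isArcHull)
  (hfac : IsStarHull.exists_isHullProduct_plus_minus)
  (h33 : exists_isRestrictionMeasure_of_isHullMultiplicative)
  (h58 : IsRestrictionMeasure.eq_five_eighths_of_outer_simple)

include hJCT hsc hRM hexΦ in
/-- **Restriction over hull subdomains ⇒ multiplicativity over smooth hulls** for the pull-back
law: every smooth `*`-hull `J` is `φ.pullbackHull D'` for a Jordan hull subdomain `D'`
(`ArcHullDomains`), and there the restriction identity pulls back to
`P̃ {K ∩ (A · J) = ∅} = P̃ {K ∩ A = ∅} P̃ {K ∩ J = ∅}` (`pullbackLaw_avoid_hullProduct`).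
[cite: LawlerSchrammWerner2003Restriction, Prop. 3.3 (1) (p. 10), transposed] -/
theorem ChordalFamily.isArcHullMultiplicative_pullbackLaw {P : ChordalFamily} (hP : P.IsChordal)
    (hcov : P.IsConformallyCovariant) (hres : P.IsHullRestriction) (hS : P.IsCarriedBySimpleCurves)
    (hφ : D.IsChordalUniformizing φ) :
    IsArcHullMultiplicative (ChordalFamily.pullbackLaw P D φ hJarc hC hφ) := by
  intro A J B hA hJa hJs hB
  obtain ⟨D', hD', hJeq⟩ := exists_isHullSubdomain_pullbackHull_eq hJCT hC hφ hJa hJs.zero_notMem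
  subst hJeq
  obtain ⟨Φ, hΦ, -⟩ := hexΦ hJs
  rw [avoid_eq_avoid_hullProduct hexΦ hA hJs hB hΦ]
  exact ChordalFamily.pullbackLaw_avoid_hullProduct hP hcov hres hS hJarc hC hsc hRM hφ hD' hΦ hA

include hJCT hsc hRM hexΦ hFa h21 hfac h33 h58 in
/-- **The pull-back law of a restriction family carried by simple curves is `P_{5/8}`**
([LSW] Prop. 3.3 (1) ⇒ (3) and p. 5 result 2, first sentence, for the pull-back law).
[cite: LawlerSchrammWerner2003Restriction, Prop. 3.3 (pp. 10–11) and p. 5 result 2] -/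
theorem ChordalFamily.isRestrictionMeasure_pullbackLaw {P : ChordalFamily} (hP : P.IsChordal)
    (hcov : P.IsConformallyCovariant) (hres : P.IsHullRestriction) (hS : P.IsCarriedBySimpleCurves)
    (hφ : D.IsChordalUniformizing φ) :
    IsRestrictionMeasure (5 / 8) (ChordalFamily.pullbackLaw P D φ hJarc hC hφ) := by
  haveI : IsProbabilityMeasure (P D) := (hP D).1
  have hcar : ∀ D : DobrushinDomain, ∀ᵐ c ∂P D, c ∈ chordalCarrier D :=
    ChordalFamily.ae_mem_chordalCarrier hP hS
  have hscale := ChordalFamily.isScaleInvariant_pullbackLaw hcov hcar hJarc hC hφ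
  have harc := ChordalFamily.isArcHullMultiplicative_pullbackLaw hJCT hJarc hC hsc hRM hexΦ
    hP hcov hres hS hφ
  have hmult := harc.isHullMultiplicative h21 hfac hexΦ hFa
  obtain ⟨α, -, hαP⟩ := h33 _ inferInstance hscale hmult
  have hα : α = 5 / 8 := h58 hαP fun T hT hsub ↦ by
    rw [ChordalFamily.pullbackLaw_apply _ hT]
    have : pullbackConfig hJarc hC hφ ⁻¹' T = univ :=
      eq_univ_of_forall fun c ↦ hsub (isSimplePath_pullbackConfig c)
    rw [this, measure_univ]
  subst hα
  exact hαP

end Pullback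

/-! ### Back to the domain: avoidance probabilities of test sets -/

section Back

/-- **Avoidance probability of an anchored test set in terms of the pull-back law.** For a
family carried by the chordal carrier and a closed bounded `T ⊆ ℍ̄`, `0 ∉ T`, whose fill is a
`*`-hull: `P D {trace ∩ φ(T) = ∅} = P̃ {K ∩ hpFill T = ∅}`. [folklore] -/
theorem measure_rangeSubset_compl_image_eq (hJarc : Literature.Topology.PlaneTopology.JordanArcSeparation)
    (hC : JordanDomain.exists_continuousOn_extension) (hφ : D.IsChordalUniformizing φ)
    (P : ChordalFamily) (hcar : ∀ᵐ c ∂P D, c ∈ chordalCarrier D) {T : Set ℂ} (hT : IsClosed T)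
    (hTb : Bornology.IsBounded T) (hTcl : T ⊆ closure upperHalfPlaneSet) (h0 : (0 : ℂ) ∉ T)
    (hfill : IsStarHull (hpFill T)) :
    P D (CurveClass.rangeSubset (φ.boundaryExtension '' T)ᶜ) =
      ChordalFamily.pullbackLaw P D φ hJarc hC hφ (avoid (hpFill T)) := by
  rw [ChordalFamily.pullbackLaw_apply _ (measurableSet_avoid hfill)]
  refine measure_congr ?_
  filter_upwards [hcar] with c hc
  refine propext ?_
  change c ∈ CurveClass.rangeSubset (φ.boundaryExtension '' T)ᶜ ↔
    pullbackConfig hJarc hC hφ c ∈ avoid (hpFill T)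
  rw [← disjoint_pullbackTrace_iff_mem_rangeSubset hC hφ hc hTcl h0, mem_avoid,
    RestrictionConfig.disjoint_hpFill_iff _ hT hTb, coe_pullbackConfig hc]

/-- **If the fill of `T` swallows `0`, no chordal simple curve avoids `φ(T)`**: its pulled-back
trace is a transient simple path from `0` avoiding `T`, which forces `0 ∉ hpFill T`
(`zero_notMem_hpFill_of_disjoint`). [folklore] -/
theorem measure_rangeSubset_compl_image_eq_zero (hC : JordanDomain.exists_continuousOn_extension)
    (hφ : D.IsChordalUniformizing φ) (P : ChordalFamily)
    (hcar : ∀ᵐ c ∂P D, c ∈ chordalCarrier D) {T : Set ℂ} (hT : IsClosed T)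
    (hTcl : T ⊆ closure upperHalfPlaneSet) (h0 : (0 : ℂ) ∉ T) (hfill : (0 : ℂ) ∈ hpFill T) :
    P D (CurveClass.rangeSubset (φ.boundaryExtension '' T)ᶜ) = 0 := by
  rw [← measure_empty (μ := P D)]
  refine measure_congr ?_
  filter_upwards [hcar] with c hc
  refine propext ⟨fun h ↦ ?_, fun h ↦ absurd h (Set.notMem_empty c)⟩
  change c ∈ CurveClass.rangeSubset (φ.boundaryExtension '' T)ᶜ at h
  rw [← disjoint_pullbackTrace_iff_mem_rangeSubset hC hφ hc hTcl h0] at h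
  obtain ⟨β, hβc, -, hβ0, hβim, hβinf, hβeq⟩ := exists_simplePath_pullbackTrace hC hφ hc
  refine (zero_notMem_hpFill_of_disjoint hT hβc hβ0 hβim hβinf ?_) hfill
  rw [Set.disjoint_left]
  rintro _ ⟨t, rfl⟩ htT
  rcases eq_or_lt_of_le (show (0 : ℝ≥0) ≤ t from bot_le) with ht | ht
  · rw [← ht, hβ0] at htT
    exact h0 htT
  · exact Set.disjoint_left.1 h (hβeq ▸ ⟨t, (ht : 0 < t), rfl⟩) htT

end Back

/-! ### The assembly -/

/-- **[LSW] p. 5 result 2, uniqueness half, from the printed facts** (module docstring):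
`LawlerSchrammWerner2003_unique` holds given the Jordan curve theorem and arc non-separation
(`hJCT`, `hJarc`), Carathéodory (`hC`), Riemann mapping (`hsc`, `hRM`), `Φ_A` and `Φ'_A(0)`
(`hexΦ`, `hex`), Conway VIII.2.2 (`hFa`), and the [LSW] facts Lemma 2.1 (`h21`),
`±`-factorisation (`hfac`), Prop. 3.3 (1) ⇒ (3) (`h33`) and p. 5 result 2 first sentence
(`h58`). [cite: LawlerSchrammWerner2003Restriction, p. 5 result 2; Prop. 3.3 with Lemma 3.2 (pp. 10–11), Thm. 7.3 (p. 29), Cor. 8.6 (p. 37)] -/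
theorem LawlerSchrammWerner2003_unique_of_facts (hJCT : Literature.Topology.PlaneTopology.JordanCurveTheorem)
    (hJarc : Literature.Topology.PlaneTopology.JordanArcSeparation) (hC : JordanDomain.exists_continuousOn_extension)
    (hsc : ∀ D : JordanDomain, D.isSimplyConnected)
    (hRM : ∀ {U : Set ℂ}, exists_conformalEquiv_ball (U := U))
    (hexΦ : IsStarHull.existsUnique_isRestrictionMap) (hex : IsStarHull.exists_hasRestrictionDeriv)
    (hFa : isSimplyConnected_of_isConnected_compl) (h21 : IsPlusHull.exists_antitone_isArcHull)
    (hfac : IsStarHull.exists_isHullProduct_plus_minus)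
    (h33 : exists_isRestrictionMeasure_of_isHullMultiplicative)
    (h58 : IsRestrictionMeasure.eq_five_eighths_of_outer_simple) :
    LawlerSchrammWerner2003_unique := by
  intro P Q hP hPcov hPres hPS hQ hQcov hQres hQS D
  haveI : IsProbabilityMeasure (P D) := (hP D).1
  haveI : IsProbabilityMeasure (Q D) := (hQ D).1
  -- a chordal uniformizing map of `D`
  obtain ⟨φ, hφ⟩ := MarkedDomain.exists_isChordalUniformizing_of_disc hsc hRM hC D
  have hPc : ∀ᵐ c ∂P D, c ∈ chordalCarrier D := ChordalFamily.ae_mem_chordalCarrier hP hPS D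
  have hQc : ∀ᵐ c ∂Q D, c ∈ chordalCarrier D := ChordalFamily.ae_mem_chordalCarrier hQ hQS D
  -- both pull-back laws are `P_{5/8}`
  have hPt := ChordalFamily.isRestrictionMeasure_pullbackLaw hJCT hJarc hC hsc hRM hexΦ hFa h21
    hfac h33 h58 hP hPcov hPres hPS hφ
  have hQt := ChordalFamily.isRestrictionMeasure_pullbackLaw hJCT hJarc hC hsc hRM hexΦ hFa h21
    hfac h33 h58 hQ hQcov hQres hQS hφ
  have havoid : ∀ {A : Set ℂ}, IsStarHull A →
      ChordalFamily.pullbackLaw P D φ hJarc hC hφ (avoid A) =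
        ChordalFamily.pullbackLaw Q D φ hJarc hC hφ (avoid A) := fun hA ↦ by
    obtain ⟨Φ, hΦ, -⟩ := hexΦ hA
    obtain ⟨d, -, -, hd⟩ := hex hA hΦ
    rw [hPt.2 hA hΦ hd, hQt.2 hA hΦ hd]
  -- transfer to `D` through the anchored test sets
  refine CurveClass.Measure.ext_of_missCode_injOn (fun n ↦ isClosed_imageTest hC n)
    measurableSet_chordalCarrier (injOn_missCode_imageTest hJarc hC hφ) hPc hQc fun s ↦ ?_
  obtain ⟨hanch, hcpt, hcl, h0⟩ := biUnion_anchoredSeq s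
  rw [biUnion_imageTest]
  set T : Set ℂ := ⋃ n ∈ s, anchoredSeq n with hT
  have hTc : IsClosed T := hcpt.isClosed
  have hTb : Bornology.IsBounded T := hcpt.isBounded
  rcases hanch with hempty | hanch
  · -- no test set: both sides are total masses
    rw [hempty, image_empty]
    have : (CurveClass.rangeSubset (∅ : Set ℂ)ᶜ : Set (CurveClass ℂ)) = univ := by
      ext c; simp [CurveClass.mem_rangeSubset]
    rw [this, measure_univ, measure_univ]
  by_cases hfill : (0 : ℂ) ∈ hpFill T
  · rw [measure_rangeSubset_compl_image_eq_zero hC hφ P hPc hTc hcl h0 hfill,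
      measure_rangeSubset_compl_image_eq_zero hC hφ Q hQc hTc hcl h0 hfill]
  · have hstar : IsStarHull (hpFill T) := isStarHull_hpFill hFa hTc hTb hanch.2 hfill
    rw [measure_rangeSubset_compl_image_eq hJarc hC hφ P hPc hTc hTb hcl h0 hstar,
      measure_rangeSubset_compl_image_eq hJarc hC hφ Q hQc hTc hTb hcl h0 hstar, havoid hstar]

end Literature.Probability.RandomPlanarGeometry

end
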